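import Mathlib.GroupTheory.SemidirectProduct
import Mathlib.Topology.LocalAtTarget
import Mathlib.Topology.Homotopy.Lifting
import Mathlib.LinearAlgebra.Matrix.SpecialLinearGroup
import Mathlib.Data.Int.Cast.Lemmas
import Literature.Topology.FourManifolds.SectionCircleNbhd
import Literature.Topology.FourManifolds.MappingTorusProofs
import HarnessLib

/-!
# The universal cover of the complement of the section circle of a Cappell–Shaneson mapping torus

Second file of the decomposition (D-0014 `provefact`) of the named fact
`Literature.Topology.FourManifolds.simplyConnectedSpace_of_isCappellShanesonSphere` (Cappell–Shaneson spheres are simply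
connected; Cappell–Shaneson, *Some new four-manifolds*, Ann. of Math. 104 (1976), §2). It
provides the covering-space input for the group-theoretic fact
`Literature.Topology.FourManifolds.CappellShaneson.normalClosure_pushOff_eq_top` of `CappellShanesonSimplyConnected.lean`
(the group of the complement of the section circle `c` of the mapping torus `T_A` of
`A ∈ SL(3, ℤ)` acting on `T³` is normally generated by a push-off of `c`), discharged in
`CappellShanesonProofs.lean`:

* `Literature.CappellShaneson.Deck A = ℤ³ ⋊_A ℤ` (Mathlib's `SemidirectProduct`, both factors written
  multiplicatively; `deckAut A k = A^k` on `ℤ³`), and the algebraic heart of Cappell–Shaneson's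
  observation: **`Deck.normalClosure_eq_top`** — if `det (A - 1) = ±1`, every element of degree
  `±1` normally generates `ℤ³ ⋊_A ℤ` (the commutators with `ℤ³` give `(1 - A^{±1}) ℤ³ = ℤ³`).
* The action `⟨n, k⟩ • (x, t) = (A^k x + 2π n, t + k)` of `Deck A` on `ℝ³ × ℝ`
  (`Deck.mulAction`), the map `cover A : ℝ³ × ℝ → MappingTorus (torusDiffeomorph A)`,
  `(x, t) ↦ [(expT x, t)]`, and **`isQuotientCoveringMap_cover`**: it is a quotient covering map
  with deck group `Deck A` (fibres = orbits: `cover_eq_cover_iff`, from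
  `MappingTorus.mk_eq_mk_iff`, the equivariance `A^k (expT x) = expT (A^k x)`
  (`monodromy_zpow_expT`) and `ker expT = 2πℤ³` (`expT_eq_expT_iff`); covering space action:
  `exists_nhds_smul_inter_eq`; open: `isOpenMap_expT`, `MappingTorus.isOpenMap_mk`).
* The section `modelSection A = {[(1, t)]}` of the model mapping torus, its preimage
  `2πℤ³ × ℝ` (`cover_mem_modelSection_iff`), the invariant complement
  `coverSub A = (ℝ³ ∖ 2πℤ³) × ℝ` (a `SubMulAction`), the restricted covering
  `coverRestrict A : ↥(coverSub A) → ↥(modelSection A)ᶜ` and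
  **`isQuotientCoveringMap_coverRestrict`**. That the total space `(ℝ³ ∖ 2πℤ³) × ℝ` is simply
  connected (general position in dimension `3`) is proved in `CappellShanesonProofs.lean`
  (`simplyConnectedSpace_coverSub`), after which Mathlib's
  `IsQuotientCoveringMap.fundamentalGroupEquiv` (Hatcher, *Algebraic Topology*, Prop. 1.40)
  computes `π₁(T_A ∖ section) ≅ (ℤ³ ⋊_A ℤ)ᵒᵖ`.

Sources: Cappell–Shaneson, Ann. of Math. 104 (1976), §2 (`T_A`, its universal cover `ℝ⁴`, and
`π₁ T_A = ℤ³ ⋊_A ℤ` are used there without comment); Hatcher, *Algebraic Topology* (2002), §1.3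
(covering space actions, Prop. 1.40) [HatcherAT2002]; Gompf, Algebr. Geom. Topol. 10 (2010), §2.
All statements here are folklore covering-space theory; the only Cappell–Shaneson-specific input
is the determinant condition in `Deck.normalClosure_eq_top`.

## Design notes

* `Deck A` is an `abbrev` for the Mathlib semidirect product, so that Mathlib's API (`inl`, `inr`,
  `inl_aut`, `mul_left`, …) applies verbatim; the two instances `Deck.mulAction`,
  `Deck.continuousConstSMul` have the H21 constant `deckAut A` in their head and cannot clash
  with Mathlib instances.
* The lattice is `2πℤ³` (not `ℤ³`) because `expT` (`TorusCoordinates.lean`) has period `2π`;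
  `slRealMatrix` (`SpecialLinearPath.lean`, `SectionCircleNbhd.lean`) is the real matrix of `A`.
* No declaration in this file uses `sorry`.
-/


noncomputable section

open Set Function Metric Topology
open scoped Manifold Real Matrix

namespace Literature.Topology.FourManifolds

/-- Local notation: `𝔼 n` is the model Euclidean space `EuclideanSpace ℝ (Fin n)`. -/
local notation "𝔼 " n:arg => EuclideanSpace ℝ (Fin n)

namespace CappellShaneson

/-! ### The deck group `ℤ³ ⋊_A ℤ` -/

section DeckGroup

/-- The automorphism `n ↦ B n` of the lattice `ℤ³` (written multiplicatively, as Mathlib's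
semidirect products require) defined by `B ∈ SL(3, ℤ)`: Mathlib's
`Matrix.SpecialLinearGroup.toLin' B` transported to `Multiplicative (Fin 3 → ℤ)`, with the
`mulVec` formula kept definitional (`latAut_apply`). [folklore] -/
def latAut (B : Matrix.SpecialLinearGroup (Fin 3) ℤ) : MulAut (Multiplicative (Fin 3 → ℤ)) where
  toFun n := Multiplicative.ofAdd ((B : Matrix (Fin 3) (Fin 3) ℤ) *ᵥ n.toAdd)
  invFun n := Multiplicative.ofAdd (((B⁻¹ : Matrix.SpecialLinearGroup (Fin 3) ℤ) :
    Matrix (Fin 3) (Fin 3) ℤ) *ᵥ n.toAdd)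
  left_inv n := by
    simp only [toAdd_ofAdd, Matrix.mulVec_mulVec, ← Matrix.SpecialLinearGroup.coe_mul,
      inv_mul_cancel, Matrix.SpecialLinearGroup.coe_one, Matrix.one_mulVec, ofAdd_toAdd]
  right_inv n := by
    simp only [toAdd_ofAdd, Matrix.mulVec_mulVec, ← Matrix.SpecialLinearGroup.coe_mul,
      mul_inv_cancel, Matrix.SpecialLinearGroup.coe_one, Matrix.one_mulVec, ofAdd_toAdd]
  map_mul' m n := by
    rw [toAdd_mul, Matrix.mulVec_add, ofAdd_add]

/-- The value of `latAut B`. [folklore] -/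
@[simp] theorem latAut_apply (B : Matrix.SpecialLinearGroup (Fin 3) ℤ)
    (n : Multiplicative (Fin 3 → ℤ)) :
    latAut B n = Multiplicative.ofAdd ((B : Matrix (Fin 3) (Fin 3) ℤ) *ᵥ n.toAdd) := rfl

/-- `B ↦ latAut B` is a homomorphism `SL(3, ℤ) → Aut(ℤ³)`. [folklore] -/
def latAutHom : Matrix.SpecialLinearGroup (Fin 3) ℤ →* MulAut (Multiplicative (Fin 3 → ℤ)) where
  toFun := latAut
  map_one' := by
    ext n : 1
    simp
  map_mul' B C := by
    ext n : 1
    simp [Matrix.mulVec_mulVec]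

/-- The action `k ↦ A ^ k` of `ℤ` on the lattice `ℤ³` defining the semidirect product
`ℤ³ ⋊_A ℤ` (Cappell–Shaneson, Ann. of Math. 104 (1976), §2: `π₁` of the mapping torus of `A`).
[folklore] -/
def deckAut (A : Matrix.SpecialLinearGroup (Fin 3) ℤ) :
    Multiplicative ℤ →* MulAut (Multiplicative (Fin 3 → ℤ)) :=
  latAutHom.comp (zpowersHom (Matrix.SpecialLinearGroup (Fin 3) ℤ) A)

/-- The value of `deckAut A k`: `n ↦ A ^ k n`. [folklore] -/
@[simp] theorem deckAut_apply (A : Matrix.SpecialLinearGroup (Fin 3) ℤ) (k : Multiplicative ℤ)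
    (n : Multiplicative (Fin 3 → ℤ)) :
    deckAut A k n = Multiplicative.ofAdd (((A ^ k.toAdd : Matrix.SpecialLinearGroup (Fin 3) ℤ) :
      Matrix (Fin 3) (Fin 3) ℤ) *ᵥ n.toAdd) := rfl

/-- **The deck group** `Γ_A = ℤ³ ⋊_A ℤ` of the universal cover of the mapping torus of
`A ∈ SL(3, ℤ)` acting on `T³` (and of the complement of its section circle): pairs `⟨n, k⟩` with
`⟨n₁, k₁⟩ ⟨n₂, k₂⟩ = ⟨n₁ + A^{k₁} n₂, k₁ + k₂⟩` (Mathlib's `SemidirectProduct`, both factors written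
multiplicatively) (Cappell–Shaneson, Ann. of Math. 104 (1976), §2; Hatcher, *Algebraic Topology*,
Prop. 1.40). [folklore] -/
abbrev Deck (A : Matrix.SpecialLinearGroup (Fin 3) ℤ) : Type :=
  Multiplicative (Fin 3 → ℤ) ⋊[deckAut A] Multiplicative ℤ

variable (A : Matrix.SpecialLinearGroup (Fin 3) ℤ)

/-- An integer square matrix with determinant `±1` is surjective on `ℤⁿ` (it is a unit:
Mathlib's `Matrix.mulVec_surjective_iff_isUnit`, `Matrix.isUnit_iff_isUnit_det`). [folklore] -/
theorem mulVec_surjective_of_det {m : ℕ} {M : Matrix (Fin m) (Fin m) ℤ}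
    (hM : M.det = 1 ∨ M.det = -1) : Surjective fun v : Fin m → ℤ ↦ M *ᵥ v := by
  change Surjective M.mulVec
  rw [Matrix.mulVec_surjective_iff_isUnit, Matrix.isUnit_iff_isUnit_det]
  rcases hM with h | h <;> rw [h] <;> simp

/-- For `A ∈ SL(3, ℤ)` with `det (A - 1) = ±1`, the matrices `1 - A` and `1 - A⁻¹` also have
determinant `±1`. [folklore] -/
theorem det_one_sub_zpow_unit (hA : ((A : Matrix (Fin 3) (Fin 3) ℤ) - 1).det = 1 ∨
      ((A : Matrix (Fin 3) (Fin 3) ℤ) - 1).det = -1) {ε : ℤ} (hε : ε = 1 ∨ ε = -1) :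
    (1 - ((A ^ ε : Matrix.SpecialLinearGroup (Fin 3) ℤ) : Matrix (Fin 3) (Fin 3) ℤ)).det = 1 ∨
      (1 - ((A ^ ε : Matrix.SpecialLinearGroup (Fin 3) ℤ) : Matrix (Fin 3) (Fin 3) ℤ)).det = -1 := by
  rcases hε with rfl | rfl
  · rw [zpow_one]
    have : (1 - (A : Matrix (Fin 3) (Fin 3) ℤ)) = -((A : Matrix (Fin 3) (Fin 3) ℤ) - 1) := by abel
    rw [this, Matrix.det_neg, Fintype.card_fin]
    rcases hA with h | h <;> rw [h] <;> norm_num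
  · rw [zpow_neg, zpow_one]
    have : (1 - ((A⁻¹ : Matrix.SpecialLinearGroup (Fin 3) ℤ) : Matrix (Fin 3) (Fin 3) ℤ)) =
        ((A⁻¹ : Matrix.SpecialLinearGroup (Fin 3) ℤ) : Matrix (Fin 3) (Fin 3) ℤ) *
          ((A : Matrix (Fin 3) (Fin 3) ℤ) - 1) := by
      rw [Matrix.mul_sub, mul_one, ← Matrix.SpecialLinearGroup.coe_mul, inv_mul_cancel,
        Matrix.SpecialLinearGroup.coe_one]
    rw [this, Matrix.det_mul, Matrix.SpecialLinearGroup.det_coe, one_mul]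
    exact hA

/-- **The deck group is normally generated by any element of degree `±1`** when
`det (A - 1) = ±1`: for `g = ⟨n, ε⟩ ∈ ℤ³ ⋊_A ℤ`, `ε = ±1`, the normal closure of `g` contains
the commutators `[⟨m, 0⟩, g] = ⟨(1 - A^ε) m, 0⟩`, i.e. all of `ℤ³ × 0` since `1 - A^ε` is
unimodular, hence `⟨0, ε⟩` and everything. This is the group-theoretic reason why surgery on the
section circle kills `π₁` of the mapping torus exactly when `det (A - 1) = ±1`
(Cappell–Shaneson, Ann. of Math. 104 (1976), §2). [folklore] -/
theorem Deck.normalClosure_eq_top (hA : ((A : Matrix (Fin 3) (Fin 3) ℤ) - 1).det = 1 ∨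
      ((A : Matrix (Fin 3) (Fin 3) ℤ) - 1).det = -1) (g : Deck A)
    (hg : g.right = Multiplicative.ofAdd 1 ∨ g.right = Multiplicative.ofAdd (-1)) :
    Subgroup.normalClosure ({g} : Set (Deck A)) = ⊤ := by
  set H := Subgroup.normalClosure ({g} : Set (Deck A)) with hH
  have hgH : g ∈ H := Subgroup.subset_normalClosure (mem_singleton g)
  set ε : ℤ := g.right.toAdd with hε_def
  have hε : ε = 1 ∨ ε = -1 := by
    rcases hg with h | h
    · left; rw [hε_def, h]; rfl
    · right; rw [hε_def, h]; rfl
  have hgε : g.right = Multiplicative.ofAdd ε := by rw [hε_def, ofAdd_toAdd]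
  have hg' : g = SemidirectProduct.inl g.left * SemidirectProduct.inr g.right :=
    (SemidirectProduct.inl_left_mul_inr_right g).symm
  -- Step 1: the commutators `⟨m, 0⟩ g ⟨m, 0⟩⁻¹ g⁻¹ = ⟨m - A^ε m, 0⟩` lie in `H`
  have hcomm : ∀ m : Multiplicative (Fin 3 → ℤ),
      (SemidirectProduct.inl (m * deckAut A g.right m⁻¹) : Deck A) ∈ H := by
    intro m
    have h1 : (SemidirectProduct.inl m : Deck A) * g * (SemidirectProduct.inl m)⁻¹ * g⁻¹ ∈ H :=
      H.mul_mem (Subgroup.normalClosure_normal.conj_mem g hgH _) (H.inv_mem hgH)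
    have h2 : (SemidirectProduct.inl m : Deck A) * g * (SemidirectProduct.inl m)⁻¹ * g⁻¹ =
        SemidirectProduct.inl (m * deckAut A g.right m⁻¹) := by
      conv_lhs => rw [hg']
      rw [mul_inv_rev, ← map_inv, ← map_inv, ← map_inv,
        show (SemidirectProduct.inl m : Deck A) *
            (SemidirectProduct.inl g.left * SemidirectProduct.inr g.right) *
            SemidirectProduct.inl m⁻¹ *
            (SemidirectProduct.inr g.right⁻¹ * SemidirectProduct.inl g.left⁻¹) =
          SemidirectProduct.inl m * SemidirectProduct.inl g.left *
            (SemidirectProduct.inr g.right * SemidirectProduct.inl m⁻¹ *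
              SemidirectProduct.inr g.right⁻¹) * SemidirectProduct.inl g.left⁻¹ by
          simp only [mul_assoc],
        ← SemidirectProduct.inl_aut, ← map_mul, ← map_mul, ← map_mul]
      congr 1
      rw [mul_right_comm (m * g.left), mul_inv_cancel_right]
    rwa [h2] at h1
  -- Step 2: hence `H ⊇ ℤ³ × 0`, because `1 - A^ε` is unimodular
  have hinl : ∀ v : Multiplicative (Fin 3 → ℤ), (SemidirectProduct.inl v : Deck A) ∈ H := by
    intro v
    obtain ⟨m, hm⟩ := mulVec_surjective_of_det (det_one_sub_zpow_unit A hA hε) v.toAdd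
    convert hcomm (Multiplicative.ofAdd m) using 2
    apply Multiplicative.toAdd.injective
    simp only [map_inv, toAdd_mul, toAdd_inv, deckAut_apply, toAdd_ofAdd, hgε, ← hm]
    rw [Matrix.sub_mulVec, Matrix.one_mulVec, sub_eq_add_neg]
  -- Step 3: `⟨0, ε⟩ ∈ H`, and `ε = ±1` generates `ℤ`
  have hinr1 : (SemidirectProduct.inr g.right : Deck A) ∈ H := by
    have : (SemidirectProduct.inr g.right : Deck A) = (SemidirectProduct.inl g.left)⁻¹ * g := by
      rw [eq_inv_mul_iff_mul_eq, ← hg']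
    rw [this]
    exact H.mul_mem (H.inv_mem (hinl _)) hgH
  have hinr : ∀ k : Multiplicative ℤ, (SemidirectProduct.inr k : Deck A) ∈ H := by
    intro k
    have hk : k = g.right ^ (ε * k.toAdd) := by
      apply Multiplicative.toAdd.injective
      rw [hgε, ← ofAdd_zsmul, toAdd_ofAdd, smul_eq_mul]
      rcases hε with h | h <;> rw [h] <;> ring
    rw [hk, map_zpow]
    exact H.zpow_mem hinr1 _
  -- Step 4: everything
  rw [eq_top_iff]
  intro x _
  rw [← SemidirectProduct.inl_left_mul_inr_right x]
  exact H.mul_mem (hinl _) (hinr _)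

end DeckGroup

/-! ### Lattice vectors and the linear action on `ℝ³` -/

section Lattice

/-- The lattice vector `2π n ∈ ℝ³` of `n ∈ ℤ³` (the kernel of `expT` is `2πℤ³`). [folklore] -/
def latVec (n : Fin 3 → ℤ) : 𝔼 3 := WithLp.toLp 2 fun j ↦ 2 * π * (n j : ℝ)

/-- Coordinates of a lattice vector. [folklore] -/
@[simp] theorem latVec_apply (n : Fin 3 → ℤ) (j : Fin 3) : latVec n j = 2 * π * (n j : ℝ) := rfl

/-- `latVec` is additive. [folklore] -/
theorem latVec_add (m n : Fin 3 → ℤ) : latVec (m + n) = latVec m + latVec n := by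
  ext j; simp [mul_add]

/-- `latVec 0 = 0`. [folklore] -/
@[simp] theorem latVec_zero : latVec 0 = 0 := by
  ext j; simp

/-- `latVec (-n) = -latVec n`. [folklore] -/
theorem latVec_neg (n : Fin 3 → ℤ) : latVec (-n) = -latVec n := by
  ext j; simp

/-- `latVec` is injective. [folklore] -/
theorem latVec_injective : Injective latVec := by
  intro m n h
  ext j
  have := congrArg (fun v : 𝔼 3 ↦ v j) h
  simp only [latVec_apply] at this
  exact_mod_cast (mul_right_injective₀ (by positivity : (2 * π : ℝ) ≠ 0) this)

/-- `expT` is `2πℤ³`-periodic. [folklore] -/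
theorem expT_add_latVec (v : 𝔼 3) (n : Fin 3 → ℤ) : expT (v + latVec n) = expT v := by
  apply torusCoord_injective
  ext j : 1
  simp only [torusCoord_expT, PiLp.add_apply, latVec_apply]
  exact Circle.exp_eq_exp.2 ⟨n j, by ring⟩

/-- **The fibres of `expT`** are the cosets of `2πℤ³`. [folklore] -/
theorem expT_eq_expT_iff (v w : 𝔼 3) : expT v = expT w ↔ ∃ n : Fin 3 → ℤ, w = v + latVec n := by
  constructor
  · intro h
    have hj : ∀ j : Fin 3, ∃ m : ℤ, w j = v j + m * (2 * π) := fun j ↦ by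
      have := congrArg (fun z ↦ torusCoord z j) h
      simp only [torusCoord_expT] at this
      exact Circle.exp_eq_exp.1 this.symm
    choose m hm using hj
    refine ⟨m, ?_⟩
    ext j
    rw [PiLp.add_apply, latVec_apply, hm j]
    ring
  · rintro ⟨n, rfl⟩
    exact (expT_add_latVec v n).symm

/-- `expT v = 1` iff `v ∈ 2πℤ³`. [folklore] -/
theorem expT_eq_one_iff (v : 𝔼 3) : expT v = 1 ↔ ∃ n : Fin 3 → ℤ, v = latVec n := by
  rw [← expT_zero, eq_comm, expT_eq_expT_iff]
  simp

/-- `mulVecE` is additive (it is a linear map). [folklore] -/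
theorem mulVecE_add {m : ℕ} (M : Matrix (Fin m) (Fin m) ℝ) (v w : 𝔼 m) :
    mulVecE M (v + w) = mulVecE M v + mulVecE M w := by
  simp only [mulVecE_eq_toEuclideanLin, map_add]

/-- `mulVecE M` is continuous (a linear map of a finite-dimensional space). [folklore] -/
theorem continuous_mulVecE {m : ℕ} (M : Matrix (Fin m) (Fin m) ℝ) : Continuous (mulVecE M) := by
  have : mulVecE M = fun v ↦ Matrix.toEuclideanLin M v := funext (mulVecE_eq_toEuclideanLin M)
  rw [this]
  exact LinearMap.continuous_of_finiteDimensional _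

/-- **The linear action preserves the lattice**: `B (2π n) = 2π (B n)` for `B ∈ SL(3, ℤ)`.
[folklore] -/
theorem mulVecE_latVec (B : Matrix.SpecialLinearGroup (Fin 3) ℤ) (n : Fin 3 → ℤ) :
    mulVecE (slRealMatrix B) (latVec n) = latVec ((B : Matrix (Fin 3) (Fin 3) ℤ) *ᵥ n) := by
  ext i
  simp only [mulVecE_apply, slRealMatrix_apply, latVec_apply, Matrix.mulVec, dotProduct,
    Int.cast_sum, Int.cast_mul, Finset.mul_sum]
  refine Finset.sum_congr rfl fun j _ ↦ ?_
  ring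

end Lattice

/-! ### The action of the deck group on `ℝ³ × ℝ` -/

section Action

variable (A : Matrix.SpecialLinearGroup (Fin 3) ℤ)

/-- **The deck transformations.** `⟨n, k⟩ ∈ ℤ³ ⋊_A ℤ` acts on `ℝ³ × ℝ` by
`(x, t) ↦ (A^k x + 2π n, t + k)`; these are the deck transformations of the universal covering
`ℝ³ × ℝ → T_A`, `(x, t) ↦ [(expT x, t)]`, of the mapping torus `T_A = T³ × ℝ / (z, t) ∼ (A z, t + 1)`
(Cappell–Shaneson, Ann. of Math. 104 (1976), §2; Hatcher, *Algebraic Topology*, §1.3). An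
instance on Mathlib types whose head symbol involves `Literature.Topology.FourManifolds.CappellShaneson.deckAut`, so it cannot
clash with a Mathlib instance. [folklore] -/
instance Deck.mulAction : MulAction (Deck A) (𝔼 3 × ℝ) where
  smul g p := (mulVecE (slRealMatrix (A ^ g.right.toAdd)) p.1 + latVec g.left.toAdd,
    p.2 + ((g.right.toAdd : ℤ) : ℝ))
  one_smul p := by
    obtain ⟨x, t⟩ := p
    change (mulVecE (slRealMatrix (A ^ (1 : Deck A).right.toAdd)) x + latVec (1 : Deck A).left.toAdd,
      t + (((1 : Deck A).right.toAdd : ℤ) : ℝ)) = (x, t)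
    simp [slRealMatrix_one]
  mul_smul g h p := by
    obtain ⟨x, t⟩ := p
    change (mulVecE (slRealMatrix (A ^ (g * h).right.toAdd)) x + latVec (g * h).left.toAdd,
        t + (((g * h).right.toAdd : ℤ) : ℝ)) =
      (mulVecE (slRealMatrix (A ^ g.right.toAdd))
          (mulVecE (slRealMatrix (A ^ h.right.toAdd)) x + latVec h.left.toAdd) + latVec g.left.toAdd,
        t + ((h.right.toAdd : ℤ) : ℝ) + ((g.right.toAdd : ℤ) : ℝ))
    ext : 1
    · simp only [SemidirectProduct.mul_right, SemidirectProduct.mul_left, toAdd_mul, zpow_add,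
        slRealMatrix_mul, ← mulVecE_mulVecE, deckAut_apply, toAdd_ofAdd, latVec_add, mulVecE_add,
        mulVecE_latVec]
      abel
    · simp only [SemidirectProduct.mul_right, toAdd_mul, Int.cast_add]
      ring

/-- The formula for the action. [folklore] -/
theorem Deck.smul_def (g : Deck A) (p : 𝔼 3 × ℝ) :
    g • p = (mulVecE (slRealMatrix (A ^ g.right.toAdd)) p.1 + latVec g.left.toAdd,
      p.2 + ((g.right.toAdd : ℤ) : ℝ)) := rfl

/-- First component of the action. [folklore] -/
@[simp] theorem Deck.smul_fst (g : Deck A) (p : 𝔼 3 × ℝ) :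
    (g • p).1 = mulVecE (slRealMatrix (A ^ g.right.toAdd)) p.1 + latVec g.left.toAdd := rfl

/-- Second component of the action: translation by the degree. [folklore] -/
@[simp] theorem Deck.smul_snd (g : Deck A) (p : 𝔼 3 × ℝ) :
    (g • p).2 = p.2 + ((g.right.toAdd : ℤ) : ℝ) := rfl

/-- The deck transformations are continuous. [folklore] -/
instance Deck.continuousConstSMul : ContinuousConstSMul (Deck A) (𝔼 3 × ℝ) :=
  ⟨fun _ ↦ (((continuous_mulVecE _).comp continuous_fst).add continuous_const).prodMk
    (continuous_snd.add continuous_const)⟩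

end Action

/-! ### The universal covering `ℝ³ × ℝ → T_A` -/

section Cover

variable (A : Matrix.SpecialLinearGroup (Fin 3) ℤ)

/-- The monodromy `torusDiffeomorph A` of the Cappell–Shaneson mapping torus as a homeomorphism
of `T³`. [folklore] -/
abbrev monodromyHomeo : ThreeTorus ≃ₜ ThreeTorus := (torusDiffeomorph A).toHomeomorph

/-- **The universal covering map** `ℝ³ × ℝ → T_A = MappingTorus (torusDiffeomorph A)`,
`(x, t) ↦ [(expT x, t)]` (Cappell–Shaneson, Ann. of Math. 104 (1976), §2: `T_A` is covered by
`ℝ⁴` with deck group `ℤ³ ⋊_A ℤ`; Hatcher, *Algebraic Topology*, §1.3). [folklore] -/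
def cover (p : 𝔼 3 × ℝ) : MappingTorus (monodromyHomeo A) :=
  MappingTorus.mk (monodromyHomeo A) (expT p.1) p.2

/-- The covering map is continuous. [folklore] -/
theorem continuous_cover : Continuous (cover A) :=
  (MappingTorus.continuous_mk _).comp (continuous_expT.prodMap continuous_id)

/-- The inverse of `torusDiffeomorph A` is `torusMap ↑A⁻¹`. [folklore] -/
theorem torusDiffeomorph_symm_apply (z : ThreeTorus) :
    (torusDiffeomorph A).symm z = torusMap ((A⁻¹ : Matrix.SpecialLinearGroup (Fin 3) ℤ) :
      Matrix (Fin 3) (Fin 3) ℤ) z := rfl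

/-- **Iterates of the monodromy in exponential coordinates**: `A^k (expT x) = expT (A^k x)` for
all `k ∈ ℤ`. [folklore] -/
theorem monodromy_zpow_expT (k : ℤ) (x : 𝔼 3) :
    ((monodromyHomeo A).toEquiv ^ k) (expT x) = expT (mulVecE (slRealMatrix (A ^ k)) x) := by
  rw [Diffeomorph.toHomeomorph_toEquiv]
  induction k using Int.induction_on generalizing x with
  | zero => simp [slRealMatrix_one]
  | succ i ih =>
    rw [zpow_add_one, Equiv.Perm.mul_apply, Diffeomorph.coe_toEquiv, coe_torusDiffeomorph,
      torusMap_expT', ih, mulVecE_mulVecE, ← slRealMatrix_mul, ← zpow_add_one]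
  | pred i ih =>
    rw [zpow_sub_one, Equiv.Perm.mul_apply, Equiv.Perm.inv_def]
    change ((torusDiffeomorph A).toEquiv ^ (-(i : ℤ)))
      (torusMap ((A⁻¹ : Matrix.SpecialLinearGroup (Fin 3) ℤ) : Matrix (Fin 3) (Fin 3) ℤ) (expT x)) = _
    rw [torusMap_expT', ih, mulVecE_mulVecE, ← slRealMatrix_mul, ← zpow_sub_one]

/-- The monodromy and its iterates fix `1 = expT 0`. [folklore] -/
theorem monodromy_zpow_one (k : ℤ) : ((monodromyHomeo A).toEquiv ^ k) 1 = 1 := by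
  rw [← expT_zero, monodromy_zpow_expT, mulVecE_zero]

/-- **The fibres of the covering are the orbits of the deck group**:
`cover A p = cover A q ↔ q = g • p` for some `g ∈ ℤ³ ⋊_A ℤ`. [folklore] -/
theorem cover_eq_cover_iff (p q : 𝔼 3 × ℝ) : cover A p = cover A q ↔ ∃ g : Deck A, g • p = q := by
  obtain ⟨x, s⟩ := p
  obtain ⟨y, t⟩ := q
  rw [cover, cover, MappingTorus.mk_eq_mk_iff]
  dsimp only
  constructor
  · rintro ⟨k, hk, hy⟩
    rw [monodromy_zpow_expT, expT_eq_expT_iff] at hy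
    obtain ⟨n, hn⟩ := hy
    refine ⟨⟨Multiplicative.ofAdd (-n), Multiplicative.ofAdd k⟩, ?_⟩
    rw [Deck.smul_def]
    simp only [toAdd_ofAdd]
    rw [hn, hk, latVec_neg, add_neg_cancel_right]
  · rintro ⟨g, hg⟩
    rw [Deck.smul_def, Prod.mk.injEq] at hg
    refine ⟨g.right.toAdd, hg.2.symm, ?_⟩
    rw [monodromy_zpow_expT, ← hg.1, expT_add_latVec]

/-- **The action is a covering space action**: every point of `ℝ³ × ℝ` has a neighbourhood
`U` (the box `|t - t₀| < 1/2`, `|xⱼ - x₀ⱼ| < π`) with `g U ∩ U = ∅` for all `g ≠ 1`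
(Hatcher, *Algebraic Topology*, §1.3, condition (∗) before Prop. 1.40). [folklore] -/
theorem exists_nhds_smul_inter_eq (p : 𝔼 3 × ℝ) :
    ∃ U ∈ 𝓝 p, ∀ g : Deck A, ((g • ·) '' U ∩ U).Nonempty → g = 1 := by
  obtain ⟨x₀, t₀⟩ := p
  let U : Set (𝔼 3 × ℝ) := {q | |q.2 - t₀| < 1 / 2 ∧ ∀ j, |q.1 j - x₀ j| < π}
  have hUo : IsOpen U := by
    apply IsOpen.and
    · exact isOpen_lt (Continuous.abs (by fun_prop)) continuous_const
    · rw [Set.setOf_forall]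
      exact isOpen_iInter_of_finite fun j ↦
        isOpen_lt (Continuous.abs (by fun_prop)) continuous_const
  have hpU : ((x₀, t₀) : 𝔼 3 × ℝ) ∈ U := ⟨by simp, fun j ↦ by simp [Real.pi_pos]⟩
  refine ⟨U, hUo.mem_nhds hpU, fun g hg ↦ ?_⟩
  obtain ⟨_, ⟨q, hqU, rfl⟩, hgqU⟩ := hg
  obtain ⟨hq2, hq1⟩ := hqU
  obtain ⟨hgq2, hgq1⟩ := hgqU
  -- the degree is `0`
  have hk : g.right.toAdd = 0 := by
    rw [Deck.smul_snd] at hgq2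
    have h1 : |((g.right.toAdd : ℤ) : ℝ)| < 1 := by
      have := abs_sub_lt_iff.1 hq2
      have := abs_sub_lt_iff.1 hgq2
      rw [abs_lt]
      constructor <;> linarith
    have h2 : |g.right.toAdd| < 1 := by exact_mod_cast h1
    exact Int.abs_lt_one_iff.1 h2
  -- the translation is `0`
  have hn : g.left.toAdd = 0 := by
    funext j
    have h1 := hgq1 j
    rw [Deck.smul_fst, hk, zpow_zero, slRealMatrix_one, mulVecE_one, PiLp.add_apply,
      latVec_apply] at h1
    have h3 : |(2 * π) * ((g.left.toAdd j : ℤ) : ℝ)| < 2 * π := by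
      have := abs_sub_lt_iff.1 (hq1 j)
      have := abs_sub_lt_iff.1 h1
      rw [abs_lt]
      constructor <;> linarith
    rw [abs_mul, abs_of_pos Real.two_pi_pos] at h3
    have h4 : |((g.left.toAdd j : ℤ) : ℝ)| < 1 := by
      by_contra h
      rw [not_lt] at h
      have := mul_le_mul_of_nonneg_left h Real.two_pi_pos.le
      linarith
    have h5 : |g.left.toAdd j| < 1 := by exact_mod_cast h4
    exact Int.abs_lt_one_iff.1 h5
  ext
  · rw [SemidirectProduct.one_left]
    exact congrFun hn _
  · rw [SemidirectProduct.one_right]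
    exact hk

end Cover

/-! ### The covering is a quotient covering map -/

section QuotientCover

variable (A : Matrix.SpecialLinearGroup (Fin 3) ℤ)

/-- The coordinate homeomorphism `EuclideanSpace ℝ (Fin 3) ≃ₜ ℝ × ℝ × ℝ`, `v ↦ (v 0, v 1, v 2)`
(used only to see `expT` as a product of three copies of `Circle.exp`). [folklore] -/
def coordHomeomorph : 𝔼 3 ≃ₜ ℝ × ℝ × ℝ where
  toFun v := (v 0, v 1, v 2)
  invFun w := WithLp.toLp 2 ![w.1, w.2.1, w.2.2]
  left_inv v := by
    ext j
    fin_cases j <;> rfl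
  right_inv w := rfl
  continuous_toFun := by fun_prop
  continuous_invFun := (PiLp.continuous_toLp 2 _).comp
    (continuous_pi fun j ↦ by fin_cases j <;> simp <;> fun_prop)

/-- **`expT : ℝ³ → T³` is an open map** (a product of the open maps `Circle.exp`). [folklore] -/
theorem isOpenMap_expT : IsOpenMap expT := by
  have h : expT = Prod.map Circle.exp (Prod.map Circle.exp Circle.exp) ∘ coordHomeomorph := rfl
  rw [h]
  have he : IsOpenMap Circle.exp := isLocalHomeomorph_circleExp.isOpenMap
  exact (he.prodMap (he.prodMap he)).comp coordHomeomorph.isOpenMap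

/-- `expT` is surjective. [folklore] -/
theorem expT_surjective : Surjective expT := fun z ↦ ⟨logT z, expT_logT z⟩

/-- The covering map is open. [folklore] -/
theorem isOpenMap_cover : IsOpenMap (cover A) :=
  (MappingTorus.isOpenMap_mk _).comp (isOpenMap_expT.prodMap IsOpenMap.id)

/-- The covering map is surjective. [folklore] -/
theorem cover_surjective : Surjective (cover A) := by
  intro z
  obtain ⟨⟨w, t⟩, rfl⟩ := MappingTorus.mk_surjective (monodromyHomeo A) z
  obtain ⟨x, rfl⟩ := expT_surjective w
  exact ⟨(x, t), rfl⟩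

/-- **`ℝ³ × ℝ → T_A` is a quotient covering map with deck group `ℤ³ ⋊_A ℤ`** (Mathlib's
`IsQuotientCoveringMap`: a quotient map by a continuous, free and properly discontinuous action
whose orbits are the fibres); in particular it is a covering map and `T_A ≅ (ℝ³ × ℝ)/Γ_A`
(Cappell–Shaneson, Ann. of Math. 104 (1976), §2; Hatcher, *Algebraic Topology*, Prop. 1.40).
[folklore] -/
theorem isQuotientCoveringMap_cover : IsQuotientCoveringMap (cover A) (Deck A) where
  toIsQuotientMap := (isOpenMap_cover A).isQuotientMap (continuous_cover A) (cover_surjective A)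
  toContinuousConstSMul := inferInstance
  apply_eq_iff_mem_orbit {e₁ e₂} := by
    rw [MulAction.mem_orbit_iff, eq_comm]
    exact cover_eq_cover_iff A e₂ e₁
  disjoint := exists_nhds_smul_inter_eq A

end QuotientCover

/-! ### Restriction to the complement of the section circle -/

section SectionComplement

variable (A : Matrix.SpecialLinearGroup (Fin 3) ℤ)

/-- **The section of the model mapping torus** through the fixed point `1 ∈ T³`: the circle
`{[(1, t)] | t ∈ ℝ} ⊆ T_A` (Cappell–Shaneson, Ann. of Math. 104 (1976), §2). [folklore] -/
def modelSection : Set (MappingTorus (monodromyHomeo A)) :=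
  range fun t : ℝ ↦ MappingTorus.mk (monodromyHomeo A) 1 t

/-- A point `[(expT x, t)]` lies on the section iff `expT x = 1`, i.e. `x ∈ 2πℤ³`: the preimage
of the section circle in the universal cover is `2πℤ³ × ℝ`. [folklore] -/
theorem cover_mem_modelSection_iff (p : 𝔼 3 × ℝ) : cover A p ∈ modelSection A ↔ expT p.1 = 1 := by
  constructor
  · rintro ⟨t, ht⟩
    rw [cover, MappingTorus.mk_eq_mk_iff] at ht
    obtain ⟨k, -, h⟩ := ht
    rw [monodromy_zpow_one] at h
    exact h
  · intro h
    exact ⟨p.2, by rw [cover, h]⟩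

/-- The section is closed (its preimage `2πℤ³ × ℝ` under the quotient map is closed). [folklore] -/
theorem isClosed_modelSection : IsClosed (modelSection A) := by
  rw [← (isQuotientCoveringMap_cover A).toIsQuotientMap.isClosed_preimage]
  have : cover A ⁻¹' modelSection A = (fun p : 𝔼 3 × ℝ ↦ expT p.1) ⁻¹' {1} := by
    ext p
    exact cover_mem_modelSection_iff A p
  rw [this]
  exact isClosed_singleton.preimage (continuous_expT.comp continuous_fst)

/-- **The universal cover of the section complement**, as an invariant subset of `ℝ³ × ℝ`:
`E = (ℝ³ ∖ 2πℤ³) × ℝ`, the preimage of the complement of the section (a `SubMulAction` of the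
deck group, so that `↥(coverSub A)` inherits the action). [folklore] -/
def coverSub : SubMulAction (Deck A) (𝔼 3 × ℝ) where
  carrier := cover A ⁻¹' (modelSection A)ᶜ
  smul_mem' g p hp := by
    simp only [mem_preimage, mem_compl_iff] at hp ⊢
    rwa [(isQuotientCoveringMap_cover A).map_smul]

/-- Membership in `coverSub A`: `expT x ≠ 1`. [folklore] -/
theorem mem_coverSub_iff (p : 𝔼 3 × ℝ) : p ∈ coverSub A ↔ expT p.1 ≠ 1 := by
  change cover A p ∈ (modelSection A)ᶜ ↔ _
  rw [mem_compl_iff, cover_mem_modelSection_iff]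

/-- **The restricted covering** `E = (ℝ³ ∖ 2πℤ³) × ℝ → T_A ∖ (section)`. [folklore] -/
def coverRestrict : ↥(coverSub A) → ↥(modelSection A)ᶜ :=
  (modelSection A)ᶜ.restrictPreimage (cover A)

/-- The value of the restricted covering. [folklore] -/
@[simp] theorem coe_coverRestrict (e : ↥(coverSub A)) : (coverRestrict A e : MappingTorus _) =
    cover A e := rfl

/-- The deck group acts continuously on `E`. [folklore] -/
instance : ContinuousConstSMul (Deck A) ↥(coverSub A) :=
  ⟨fun g ↦ ((continuous_const_smul g).comp continuous_subtype_val).subtype_mk _⟩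

/-- **The restricted covering is a quotient covering map with the same deck group**
`ℤ³ ⋊_A ℤ` (restriction of `isQuotientCoveringMap_cover` to the saturated open set
`T_A ∖ section`). [folklore] -/
theorem isQuotientCoveringMap_coverRestrict :
    IsQuotientCoveringMap (coverRestrict A) (Deck A) where
  toIsQuotientMap := (isQuotientCoveringMap_cover A).toIsQuotientMap.restrictPreimage_isOpen
    (isClosed_modelSection A).isOpen_compl
  toContinuousConstSMul := inferInstance
  apply_eq_iff_mem_orbit {e₁ e₂} := by
    rw [MulAction.mem_orbit_iff, Subtype.ext_iff, coe_coverRestrict, coe_coverRestrict, eq_comm,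
      cover_eq_cover_iff]
    constructor
    · rintro ⟨g, hg⟩
      exact ⟨g, Subtype.ext (by rw [SubMulAction.val_smul, hg])⟩
    · rintro ⟨g, rfl⟩
      exact ⟨g, (SubMulAction.val_smul g e₂).symm⟩
  disjoint e := by
    obtain ⟨U, hU, hdisj⟩ := exists_nhds_smul_inter_eq A (e : 𝔼 3 × ℝ)
    refine ⟨Subtype.val ⁻¹' U, continuous_subtype_val.continuousAt.preimage_mem_nhds hU,
      fun g hg ↦ hdisj g ?_⟩
    obtain ⟨_, ⟨e', he', rfl⟩, hge'⟩ := hg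
    exact ⟨(g • e' : ↥(coverSub A)), ⟨e', he', (SubMulAction.val_smul g e').symm⟩, hge'⟩

end SectionComplement

end CappellShaneson

end Literature.Topology.FourManifolds
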